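import Literature.AlgebraicGeometry.Motives.AbelianVarietyInvariantHomRank
import Literature.AlgebraicGeometry.Motives.AbelianVarietyEquivariantIsogenyCharacter
import HarnessLib

/-!
# Equivariant homomorphisms are additive in biproducts:
# `Hom_G(A ⊞ A', Y) ≅ Hom_G(A, Y) × Hom_G(A', Y)` and `rk Hom_{ℤ_ℓ[G]}(T_ℓ(A ⊞ A'), T_ℓ Y) = rk(T_ℓ A) + rk(T_ℓ A')`

Let a group `G` act on abelian varieties `A`, `A'`, `Y` over a field `K` (`ρ_A`, `ρ_{A'}`, `ρ_Y`) and on a biproduct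
`P = A ⊞ A'` (a `BinaryBicone b` with `fst ≫ inl + snd ≫ inr = 𝟙`) by `ρ_P` making the injections equivariant
(`inl ≫ ρ_P(g) = ρ_A(g) ≫ inl`, `inr ≫ ρ_P(g) = ρ_{A'}(g) ≫ inr` — the "product action").  Then:

* §1 (Hom side, exact) **`rk_ℤ Hom_G(P, Y) = rk_ℤ Hom_G(A, Y) + rk_ℤ Hom_G(A', Y)`**
  (`finrank_equivariantHom_biprod_source_eq_add`): `f ↦ (inl ≫ f, inr ≫ f)` with inverse `(u, u') ↦ fst ≫ u + snd ≫ u'` is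
  an additive bijection `Hom_G(P, Y) ≅ Hom_G(A, Y) × Hom_G(A', Y)` (equivariance of `fst`, `snd` from the tree's
  `comp_fst/snd_eq_of_blockDiagonal`), and `Hom(−, Y)` is free of finite rank (Mumford §19 Thm. 3); symmetrically in the
  target, **`rk_ℤ Hom_G(X, P) = rk_ℤ Hom_G(X, A) + rk_ℤ Hom_G(X, A')`** (`finrank_equivariantHom_biprod_target_eq_add`, via
  `f ↦ (f ≫ fst, f ≫ snd)`).
* §2 (Tate side, `ℓ` invertible in `K`, `G` finite) **`rk_{ℤ_ℓ} Hom_{ℤ_ℓ[G]}(T_ℓ P, T_ℓ Y) = rk Hom_{ℤ_ℓ[G]}(T_ℓ A, T_ℓ Y)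
  + rk Hom_{ℤ_ℓ[G]}(T_ℓ A', T_ℓ Y)`** and the target version — bilinearity of the `ℓ`-adic inner product
  `|G| rk Hom_{ℤ_ℓ[G]}(T_ℓ X, T_ℓ Y) = Σ_g χ_Y(g) χ_X(g⁻¹)` (`Motives/AbelianVarietyEquivariantHomCharacterBound`) together with
  `χ_P = χ_A + χ_{A'}` (`Motives/AbelianVarietyEquivariantIsogenyCharacter`).

Everything is a theorem (no definitions); `Hom_G` and `Hom_{ℤ_ℓ[G]}` are the `⨅_g eqLocus` submodules of those files.

## References

* [MumfordAV1970] D. Mumford, *Abelian Varieties* (1970), §19 Thm. 3 and Cor. 1 (pp. 176–178: `Hom(X, Y)` f.g. free,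
  additivity of `T_ℓ`), Thm. 4 (p. 180).
* [Milne1986AbelianVarieties] J. S. Milne, *Abelian varieties*, in Cornell–Silverman (1986), §12 (Lemma 12.2, Thm. 12.5; the
  rank count along a decomposition, p. 122).
* [SerreLinearRepresentations1977] J.-P. Serre, *Linear Representations of Finite Groups*, §2.3 (bilinearity of `⟨φ, ψ⟩`,
  `dim Hom_G(V ⊕ V', W) = dim Hom_G(V, W) + dim Hom_G(V', W)`), §7.2.
* [LangeRodriguez2022] H. Lange, R. E. Rodríguez, *Decomposition of Jacobians by Prym Varieties*, LNM 2310 (2022), §2.9.1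
  Prop. 2.9.3 (PDF p. 46).
-/

noncomputable section

open CategoryTheory CategoryTheory.Limits
open Literature.RepresentationTheory.FiniteGroups
open Literature.NumberTheory.DiophantineGeometry

universe u

namespace Literature.AlgebraicGeometry.Motives

namespace AbelianVariety

/-! ## §1 `Hom_G(A ⊞ A', Y) ≅ Hom_G(A, Y) × Hom_G(A', Y)` and `Hom_G(X, A ⊞ A') ≅ Hom_G(X, A) × Hom_G(X, A')`: ranks add -/

section HomSide

variable {K : Type u} [Field K] {A A' X Y : AbelianVariety K} (b : BinaryBicone A A') {G : Type} [Group G]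
  (ρP : G →* End b.pt) (ρA : G →* End A) (ρA' : G →* End A') (ρX : G →* End X) (ρY : G →* End Y)

/-- **`rk_ℤ Hom_G(A ⊞ A', Y) = rk_ℤ Hom_G(A, Y) + rk_ℤ Hom_G(A', Y)`** for the product action on a biproduct (injections
equivariant): `f ↦ (inl ≫ f, inr ≫ f)` is an additive bijection `Hom_G(A ⊞ A', Y) ≅ Hom_G(A, Y) × Hom_G(A', Y)` with inverse
`(u, u') ↦ fst ≫ u + snd ≫ u'`, and these groups are free of finite rank. [cite: SerreLinearRepresentations1977, §2.3 (bilinearity of ⟨φ, ψ⟩)]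
[cite: MumfordAV1970, §19 Thm. 3 (pp. 176–178)] [cite: Milne1986AbelianVarieties, §12 (p. 122)] -/
theorem finrank_equivariantHom_biprod_source_eq_add (hb : b.fst ≫ b.inl + b.snd ≫ b.inr = 𝟙 b.pt)
    (hinl : ∀ g : G, b.inl ≫ End.asHom (ρP g) = End.asHom (ρA g) ≫ b.inl)
    (hinr : ∀ g : G, b.inr ≫ End.asHom (ρP g) = End.asHom (ρA' g) ≫ b.inr) :
    Module.finrank ℤ (⨅ g : G, LinearMap.eqLocus (Preadditive.leftComp Y (End.asHom (ρP g))).toIntLinearMap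
        (Preadditive.rightComp b.pt (End.asHom (ρY g))).toIntLinearMap : Submodule ℤ (b.pt ⟶ Y)) =
      Module.finrank ℤ (⨅ g : G, LinearMap.eqLocus (Preadditive.leftComp Y (End.asHom (ρA g))).toIntLinearMap
          (Preadditive.rightComp A (End.asHom (ρY g))).toIntLinearMap : Submodule ℤ (A ⟶ Y)) +
        Module.finrank ℤ (⨅ g : G, LinearMap.eqLocus (Preadditive.leftComp Y (End.asHom (ρA' g))).toIntLinearMap
          (Preadditive.rightComp A' (End.asHom (ρY g))).toIntLinearMap : Submodule ℤ (A' ⟶ Y)) := by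
  haveI : Module.Free ℤ (A ⟶ Y) := module_free_hom_holds A Y
  haveI : Module.Finite ℤ (A ⟶ Y) := module_finite_hom_holds A Y
  haveI : Module.IsTorsionFree ℤ (A ⟶ Y) := inferInstance
  haveI : Module.Free ℤ (A' ⟶ Y) := module_free_hom_holds A' Y
  haveI : Module.Finite ℤ (A' ⟶ Y) := module_finite_hom_holds A' Y
  haveI : Module.IsTorsionFree ℤ (A' ⟶ Y) := inferInstance
  set VP := (⨅ g : G, LinearMap.eqLocus (Preadditive.leftComp Y (End.asHom (ρP g))).toIntLinearMap
    (Preadditive.rightComp b.pt (End.asHom (ρY g))).toIntLinearMap : Submodule ℤ (b.pt ⟶ Y)) with hVP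
  set VA := (⨅ g : G, LinearMap.eqLocus (Preadditive.leftComp Y (End.asHom (ρA g))).toIntLinearMap
    (Preadditive.rightComp A (End.asHom (ρY g))).toIntLinearMap : Submodule ℤ (A ⟶ Y)) with hVA
  set VA' := (⨅ g : G, LinearMap.eqLocus (Preadditive.leftComp Y (End.asHom (ρA' g))).toIntLinearMap
    (Preadditive.rightComp A' (End.asHom (ρY g))).toIntLinearMap : Submodule ℤ (A' ⟶ Y)) with hVA'
  haveI : Module.Free ℤ VA := Module.free_of_finite_type_torsion_free'
  haveI : Module.Free ℤ VA' := Module.free_of_finite_type_torsion_free'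
  have hfst : ∀ g, End.asHom (ρP g) ≫ b.fst = b.fst ≫ End.asHom (ρA g) := fun g ↦
    comp_fst_eq_of_blockDiagonal b hb (hinl g) (hinr g)
  have hsnd : ∀ g, End.asHom (ρP g) ≫ b.snd = b.snd ≫ End.asHom (ρA' g) := fun g ↦
    comp_snd_eq_of_blockDiagonal b hb (hinl g) (hinr g)
  have memP := fun f ↦ mem_iInf_eqLocus_leftComp_rightComp_iff ρP ρY f
  have memA := fun f ↦ mem_iInf_eqLocus_leftComp_rightComp_iff ρA ρY f
  have memA' := fun f ↦ mem_iInf_eqLocus_leftComp_rightComp_iff ρA' ρY f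
  -- `f ↦ (inl ≫ f, inr ≫ f)` and `(u, u') ↦ fst ≫ u + snd ≫ u'`
  let e : VP ≃+ VA × VA' :=
    { toFun := fun f ↦
        (⟨b.inl ≫ (f : b.pt ⟶ Y), (memA _).2 fun g ↦ by
            rw [← Category.assoc, ← hinl g]
            simp only [Category.assoc, (memP _).1 f.2 g]⟩,
          ⟨b.inr ≫ (f : b.pt ⟶ Y), (memA' _).2 fun g ↦ by
            rw [← Category.assoc, ← hinr g]
            simp only [Category.assoc, (memP _).1 f.2 g]⟩)
      invFun := fun u ↦
        ⟨b.fst ≫ (u.1 : A ⟶ Y) + b.snd ≫ (u.2 : A' ⟶ Y), (memP _).2 fun g ↦ by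
          rw [Preadditive.comp_add, Preadditive.add_comp, ← Category.assoc, ← Category.assoc, hfst g, hsnd g]
          simp only [Category.assoc, (memA _).1 u.1.2 g, (memA' _).1 u.2.2 g]⟩
      left_inv := fun f ↦ Subtype.ext (by
        change b.fst ≫ (b.inl ≫ (f : b.pt ⟶ Y)) + b.snd ≫ (b.inr ≫ (f : b.pt ⟶ Y)) = f
        rw [← Category.assoc, ← Category.assoc, ← Preadditive.add_comp, hb, Category.id_comp])
      right_inv := fun u ↦ Prod.ext
        (Subtype.ext (by
          change b.inl ≫ (b.fst ≫ (u.1 : A ⟶ Y) + b.snd ≫ (u.2 : A' ⟶ Y)) = u.1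
          rw [Preadditive.comp_add, ← Category.assoc, ← Category.assoc, b.inl_fst, b.inl_snd, Category.id_comp,
            zero_comp, add_zero]))
        (Subtype.ext (by
          change b.inr ≫ (b.fst ≫ (u.1 : A ⟶ Y) + b.snd ≫ (u.2 : A' ⟶ Y)) = u.2
          rw [Preadditive.comp_add, ← Category.assoc, ← Category.assoc, b.inr_fst, b.inr_snd, Category.id_comp,
            zero_comp, zero_add]))
      map_add' := fun f f' ↦ Prod.ext
        (Subtype.ext (by
          change b.inl ≫ ((f : b.pt ⟶ Y) + (f' : b.pt ⟶ Y)) = b.inl ≫ (f : b.pt ⟶ Y) + b.inl ≫ (f' : b.pt ⟶ Y)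
          rw [Preadditive.comp_add]))
        (Subtype.ext (by
          change b.inr ≫ ((f : b.pt ⟶ Y) + (f' : b.pt ⟶ Y)) = b.inr ≫ (f : b.pt ⟶ Y) + b.inr ≫ (f' : b.pt ⟶ Y)
          rw [Preadditive.comp_add])) }
  calc Module.finrank ℤ VP = Module.finrank ℤ (VA × VA') := by convert e.toIntLinearEquiv.finrank_eq using 2
    _ = Module.finrank ℤ VA + Module.finrank ℤ VA' := Module.finrank_prod

/-- **`rk_ℤ Hom_G(X, A ⊞ A') = rk_ℤ Hom_G(X, A) + rk_ℤ Hom_G(X, A')`** for the product action on a biproduct (injections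
equivariant, hence projections equivariant): `f ↦ (f ≫ fst, f ≫ snd)` with inverse `(u, u') ↦ u ≫ inl + u' ≫ inr`.
[cite: SerreLinearRepresentations1977, §2.3 (bilinearity of ⟨φ, ψ⟩)] [cite: MumfordAV1970, §19 Thm. 3 (pp. 176–178)]
[cite: Milne1986AbelianVarieties, §12 (p. 122)] -/
theorem finrank_equivariantHom_biprod_target_eq_add (hb : b.fst ≫ b.inl + b.snd ≫ b.inr = 𝟙 b.pt)
    (hinl : ∀ g : G, b.inl ≫ End.asHom (ρP g) = End.asHom (ρA g) ≫ b.inl)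
    (hinr : ∀ g : G, b.inr ≫ End.asHom (ρP g) = End.asHom (ρA' g) ≫ b.inr) :
    Module.finrank ℤ (⨅ g : G, LinearMap.eqLocus (Preadditive.leftComp b.pt (End.asHom (ρX g))).toIntLinearMap
        (Preadditive.rightComp X (End.asHom (ρP g))).toIntLinearMap : Submodule ℤ (X ⟶ b.pt)) =
      Module.finrank ℤ (⨅ g : G, LinearMap.eqLocus (Preadditive.leftComp A (End.asHom (ρX g))).toIntLinearMap
          (Preadditive.rightComp X (End.asHom (ρA g))).toIntLinearMap : Submodule ℤ (X ⟶ A)) +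
        Module.finrank ℤ (⨅ g : G, LinearMap.eqLocus (Preadditive.leftComp A' (End.asHom (ρX g))).toIntLinearMap
          (Preadditive.rightComp X (End.asHom (ρA' g))).toIntLinearMap : Submodule ℤ (X ⟶ A')) := by
  haveI : Module.Free ℤ (X ⟶ A) := module_free_hom_holds X A
  haveI : Module.Finite ℤ (X ⟶ A) := module_finite_hom_holds X A
  haveI : Module.IsTorsionFree ℤ (X ⟶ A) := inferInstance
  haveI : Module.Free ℤ (X ⟶ A') := module_free_hom_holds X A'
  haveI : Module.Finite ℤ (X ⟶ A') := module_finite_hom_holds X A'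
  haveI : Module.IsTorsionFree ℤ (X ⟶ A') := inferInstance
  set VP := (⨅ g : G, LinearMap.eqLocus (Preadditive.leftComp b.pt (End.asHom (ρX g))).toIntLinearMap
    (Preadditive.rightComp X (End.asHom (ρP g))).toIntLinearMap : Submodule ℤ (X ⟶ b.pt)) with hVP
  set VA := (⨅ g : G, LinearMap.eqLocus (Preadditive.leftComp A (End.asHom (ρX g))).toIntLinearMap
    (Preadditive.rightComp X (End.asHom (ρA g))).toIntLinearMap : Submodule ℤ (X ⟶ A)) with hVA
  set VA' := (⨅ g : G, LinearMap.eqLocus (Preadditive.leftComp A' (End.asHom (ρX g))).toIntLinearMap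
    (Preadditive.rightComp X (End.asHom (ρA' g))).toIntLinearMap : Submodule ℤ (X ⟶ A')) with hVA'
  haveI : Module.Free ℤ VA := Module.free_of_finite_type_torsion_free'
  haveI : Module.Free ℤ VA' := Module.free_of_finite_type_torsion_free'
  have hfst : ∀ g, End.asHom (ρP g) ≫ b.fst = b.fst ≫ End.asHom (ρA g) := fun g ↦
    comp_fst_eq_of_blockDiagonal b hb (hinl g) (hinr g)
  have hsnd : ∀ g, End.asHom (ρP g) ≫ b.snd = b.snd ≫ End.asHom (ρA' g) := fun g ↦
    comp_snd_eq_of_blockDiagonal b hb (hinl g) (hinr g)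
  have memP := fun f ↦ mem_iInf_eqLocus_leftComp_rightComp_iff ρX ρP f
  have memA := fun f ↦ mem_iInf_eqLocus_leftComp_rightComp_iff ρX ρA f
  have memA' := fun f ↦ mem_iInf_eqLocus_leftComp_rightComp_iff ρX ρA' f
  -- `f ↦ (f ≫ fst, f ≫ snd)` and `(u, u') ↦ u ≫ inl + u' ≫ inr`
  let e : VP ≃+ VA × VA' :=
    { toFun := fun f ↦
        (⟨(f : X ⟶ b.pt) ≫ b.fst, (memA _).2 fun g ↦ by
            rw [← Category.assoc, (memP _).1 f.2 g]
            simp only [Category.assoc, hfst g]⟩,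
          ⟨(f : X ⟶ b.pt) ≫ b.snd, (memA' _).2 fun g ↦ by
            rw [← Category.assoc, (memP _).1 f.2 g]
            simp only [Category.assoc, hsnd g]⟩)
      invFun := fun u ↦
        ⟨(u.1 : X ⟶ A) ≫ b.inl + (u.2 : X ⟶ A') ≫ b.inr, (memP _).2 fun g ↦ by
          rw [Preadditive.comp_add, Preadditive.add_comp, ← Category.assoc, ← Category.assoc, (memA _).1 u.1.2 g,
            (memA' _).1 u.2.2 g]
          simp only [Category.assoc, hinl g, hinr g]⟩
      left_inv := fun f ↦ Subtype.ext (by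
        change ((f : X ⟶ b.pt) ≫ b.fst) ≫ b.inl + ((f : X ⟶ b.pt) ≫ b.snd) ≫ b.inr = f
        rw [Category.assoc, Category.assoc, ← Preadditive.comp_add, hb, Category.comp_id])
      right_inv := fun u ↦ Prod.ext
        (Subtype.ext (by
          change ((u.1 : X ⟶ A) ≫ b.inl + (u.2 : X ⟶ A') ≫ b.inr) ≫ b.fst = u.1
          rw [Preadditive.add_comp, Category.assoc, Category.assoc, b.inl_fst, b.inr_fst, Category.comp_id, comp_zero,
            add_zero]))
        (Subtype.ext (by
          change ((u.1 : X ⟶ A) ≫ b.inl + (u.2 : X ⟶ A') ≫ b.inr) ≫ b.snd = u.2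
          rw [Preadditive.add_comp, Category.assoc, Category.assoc, b.inl_snd, b.inr_snd, Category.comp_id, comp_zero,
            zero_add]))
      map_add' := fun f f' ↦ Prod.ext
        (Subtype.ext (by
          change ((f : X ⟶ b.pt) + (f' : X ⟶ b.pt)) ≫ b.fst = (f : X ⟶ b.pt) ≫ b.fst + (f' : X ⟶ b.pt) ≫ b.fst
          rw [Preadditive.add_comp]))
        (Subtype.ext (by
          change ((f : X ⟶ b.pt) + (f' : X ⟶ b.pt)) ≫ b.snd = (f : X ⟶ b.pt) ≫ b.snd + (f' : X ⟶ b.pt) ≫ b.snd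
          rw [Preadditive.add_comp])) }
  calc Module.finrank ℤ VP = Module.finrank ℤ (VA × VA') := by convert e.toIntLinearEquiv.finrank_eq using 2
    _ = Module.finrank ℤ VA + Module.finrank ℤ VA' := Module.finrank_prod

end HomSide

/-! ## §2 `rk Hom_{ℤ_ℓ[G]}(T_ℓ(A ⊞ A'), T_ℓ Y) = rk(T_ℓ A, T_ℓ Y) + rk(T_ℓ A', T_ℓ Y)`, and in the target -/

section TateSide

variable {K : Type u} [Field K] (ℓ : ℕ) [Fact ℓ.Prime] {A A' X Y : AbelianVariety K} (b : BinaryBicone A A')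
  {G : Type} [Group G] [Fintype G]
  (ρP : G →* End b.pt) (ρA : G →* End A) (ρA' : G →* End A') (ρX : G →* End X) (ρY : G →* End Y)

/-- **`rk_{ℤ_ℓ} Hom_{ℤ_ℓ[G]}(T_ℓ(A ⊞ A'), T_ℓ Y) = rk Hom_{ℤ_ℓ[G]}(T_ℓ A, T_ℓ Y) + rk Hom_{ℤ_ℓ[G]}(T_ℓ A', T_ℓ Y)`** for the
product action of a finite group and `ℓ` invertible in `K`: `|G| rk = Σ_g χ_Y(g) χ_P(g⁻¹)` with `χ_P = χ_A + χ_{A'}`.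
[cite: SerreLinearRepresentations1977, §2.3, §7.2] [cite: MumfordAV1970, §19 Thm. 3 (p. 176), Thm. 4 (p. 180)] -/
theorem finrank_equivariantTateHom_biprod_source_eq_add (hb : b.fst ≫ b.inl + b.snd ≫ b.inr = 𝟙 b.pt)
    (hinl : ∀ g : G, b.inl ≫ End.asHom (ρP g) = End.asHom (ρA g) ≫ b.inl)
    (hinr : ∀ g : G, b.inr ≫ End.asHom (ρP g) = End.asHom (ρA' g) ≫ b.inr) (hℓ : (ℓ : K) ≠ 0) :
    Module.finrank ℤ_[ℓ]
        (⨅ g : G, LinearMap.eqLocus (LinearMap.llcomp ℤ_[ℓ] _ _ _ (tateModuleMap ℓ (End.asHom (ρY g))))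
          (LinearMap.lcomp ℤ_[ℓ] _ (tateModuleMap ℓ (End.asHom (ρP g)))) :
            Submodule ℤ_[ℓ] (b.pt.tateModule ℓ →ₗ[ℤ_[ℓ]] Y.tateModule ℓ)) =
      Module.finrank ℤ_[ℓ]
          (⨅ g : G, LinearMap.eqLocus (LinearMap.llcomp ℤ_[ℓ] _ _ _ (tateModuleMap ℓ (End.asHom (ρY g))))
            (LinearMap.lcomp ℤ_[ℓ] _ (tateModuleMap ℓ (End.asHom (ρA g)))) :
              Submodule ℤ_[ℓ] (A.tateModule ℓ →ₗ[ℤ_[ℓ]] Y.tateModule ℓ)) +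
        Module.finrank ℤ_[ℓ]
          (⨅ g : G, LinearMap.eqLocus (LinearMap.llcomp ℤ_[ℓ] _ _ _ (tateModuleMap ℓ (End.asHom (ρY g))))
            (LinearMap.lcomp ℤ_[ℓ] _ (tateModuleMap ℓ (End.asHom (ρA' g)))) :
              Submodule ℤ_[ℓ] (A'.tateModule ℓ →ₗ[ℤ_[ℓ]] Y.tateModule ℓ)) := by
  have hP := card_mul_finrank_equivariantTateHom_eq_sum ℓ ρP ρY hℓ
  have hA := card_mul_finrank_equivariantTateHom_eq_sum ℓ ρA ρY hℓ
  have hA' := card_mul_finrank_equivariantTateHom_eq_sum ℓ ρA' ρY hℓ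
  simp only [trace_tateModuleMap_asHom_biprod_eq_add ℓ b ρP ρA ρA' hb hinl hinr hℓ, mul_add,
    Finset.sum_add_distrib] at hP
  rw [← hA, ← hA', ← mul_add, ← Nat.cast_add] at hP
  exact Nat.cast_inj.1 (mul_left_cancel₀ (Nat.cast_ne_zero.2 Fintype.card_ne_zero) hP)

/-- **`rk_{ℤ_ℓ} Hom_{ℤ_ℓ[G]}(T_ℓ X, T_ℓ(A ⊞ A')) = rk Hom_{ℤ_ℓ[G]}(T_ℓ X, T_ℓ A) + rk Hom_{ℤ_ℓ[G]}(T_ℓ X, T_ℓ A')`** for the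
product action of a finite group and `ℓ` invertible in `K` (`χ_P = χ_A + χ_{A'}` in the first slot of `Σ_g χ_P(g) χ_X(g⁻¹)`).
[cite: SerreLinearRepresentations1977, §2.3, §7.2] [cite: MumfordAV1970, §19 Thm. 3 (p. 176), Thm. 4 (p. 180)] -/
theorem finrank_equivariantTateHom_biprod_target_eq_add (hb : b.fst ≫ b.inl + b.snd ≫ b.inr = 𝟙 b.pt)
    (hinl : ∀ g : G, b.inl ≫ End.asHom (ρP g) = End.asHom (ρA g) ≫ b.inl)
    (hinr : ∀ g : G, b.inr ≫ End.asHom (ρP g) = End.asHom (ρA' g) ≫ b.inr) (hℓ : (ℓ : K) ≠ 0) :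
    Module.finrank ℤ_[ℓ]
        (⨅ g : G, LinearMap.eqLocus (LinearMap.llcomp ℤ_[ℓ] _ _ _ (tateModuleMap ℓ (End.asHom (ρP g))))
          (LinearMap.lcomp ℤ_[ℓ] _ (tateModuleMap ℓ (End.asHom (ρX g)))) :
            Submodule ℤ_[ℓ] (X.tateModule ℓ →ₗ[ℤ_[ℓ]] b.pt.tateModule ℓ)) =
      Module.finrank ℤ_[ℓ]
          (⨅ g : G, LinearMap.eqLocus (LinearMap.llcomp ℤ_[ℓ] _ _ _ (tateModuleMap ℓ (End.asHom (ρA g))))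
            (LinearMap.lcomp ℤ_[ℓ] _ (tateModuleMap ℓ (End.asHom (ρX g)))) :
              Submodule ℤ_[ℓ] (X.tateModule ℓ →ₗ[ℤ_[ℓ]] A.tateModule ℓ)) +
        Module.finrank ℤ_[ℓ]
          (⨅ g : G, LinearMap.eqLocus (LinearMap.llcomp ℤ_[ℓ] _ _ _ (tateModuleMap ℓ (End.asHom (ρA' g))))
            (LinearMap.lcomp ℤ_[ℓ] _ (tateModuleMap ℓ (End.asHom (ρX g)))) :
              Submodule ℤ_[ℓ] (X.tateModule ℓ →ₗ[ℤ_[ℓ]] A'.tateModule ℓ)) := by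
  have hP := card_mul_finrank_equivariantTateHom_eq_sum ℓ ρX ρP hℓ
  have hA := card_mul_finrank_equivariantTateHom_eq_sum ℓ ρX ρA hℓ
  have hA' := card_mul_finrank_equivariantTateHom_eq_sum ℓ ρX ρA' hℓ
  simp only [trace_tateModuleMap_asHom_biprod_eq_add ℓ b ρP ρA ρA' hb hinl hinr hℓ, add_mul,
    Finset.sum_add_distrib] at hP
  rw [← hA, ← hA', ← mul_add, ← Nat.cast_add] at hP
  exact Nat.cast_inj.1 (mul_left_cancel₀ (Nat.cast_ne_zero.2 Fintype.card_ne_zero) hP)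

end TateSide

end AbelianVariety

end Literature.AlgebraicGeometry.Motives
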